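import Summits.MatrixMultiplication.MatrixMultiplication.Theorems.ObstructionDescentUniversalOccurrenceTwoRectangleDetInvariants
import Literature.Barriers.Langlands.TwistedEndoscopySelfDual

set_option linter.dupNamespace false
set_option autoImplicit false

/-!
# Obstruction descent — universal occurrence: the blow-up gadget of the two-rectangle sector (K33)

Lens-3 node g45 ("one certified translation + split beneath").  K25 (`…TwoRectangleDetInvariants`)
introduced the determinantal semi-invariants `F_X(t) = det(∑_l X_l ⊗ T_l)` of the two-rectangle sector
`((δ^N),(δ^N),ν)` and evaluated them on the FLOOR (diagonal slices, rank `N`).  For `δ = 2` the variables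
`X = (X_l)_l` are `2 × 2` matrices, `SL₂ × SL₂` acts on `Mat₂ ≅ (ℂ⁴, det)` through `SO₄`, and the
`GL(W)`-type of `F_X(t)` as a polynomial in `X` is governed by two kinds of `SL₂ × SL₂`-invariants of a
tuple of `2 × 2` matrices: the POLARISED DETERMINANTS `q(X,Y) = det(X+Y) − det X − det Y` (Gram matrix of
the quadratic form `det`; even `GL(W)`-types only) and the BRACKET `Δ(A,B,C,D) = det[vec A | vec B | vec C | vec D]`
(type `(1,1,1,1)`).  Blockwise transposition `X_l ↦ X_lᵀ` is an improper isometry of `(Mat₂, det)`: it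
fixes every `q` and negates `Δ`.

This file proves, sorry-free and `def`-free, the ALGEBRAIC HEART of the "storey dictionary" of the node:

* (the `4 × 4` Laplace expansion is the tree's `Literature.Barriers.Langlands.Endoscopy.det_fin_four`);
* `blowUp_gadget_two_mul_det` — the normal form of the `2 × 2`-block determinant:
  `2·det[[A,B],[C,D]] = 2 det A det D + 2 det B det C + q(A,D) q(B,C) − q(A,B) q(C,D) − q(A,C) q(B,D) + Δ(A,B,C,D)`;
* `blowUp_gadget_det_sub_det_transpose` — its antisymmetric part under blockwise transposition is
  EXACTLY the bracket: `det[[A,B],[C,D]] − det[[Aᵀ,Bᵀ],[Cᵀ,Dᵀ]] = Δ(A,B,C,D)` (any commutative ring);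
* `blowUp_polarDet_transpose`, `blowUp_bracket_transpose` — `q(Xᵀ,Yᵀ) = q(X,Y)`, `Δ(Aᵀ,Bᵀ,Cᵀ,Dᵀ) = −Δ(A,B,C,D)`;
* `blowUp_pencil_two_det` — for a `2 × 2 × n` tensor `s` the blow-up determinant `det(∑_l X_l ⊗ s(·,·,l))`
  IS the block determinant of the blocks `Y_{ij} = ∑_l s_{ijl} X_l`;
* `blowUp_crossedBlock_det_sub_det_transpose` — for the CROSSED BLOCK `s×` (slices `s×(i,j,·) = e_{c i j}`,
  i.e. the restriction of `⟨4⟩` given by `e₀⊗e₀⊗e_{c₀₀} + e₀⊗e₁⊗e_{c₀₁} + e₁⊗e₀⊗e_{c₁₀} + e₁⊗e₁⊗e_{c₁₁}`)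
  the antisymmetric part of the blow-up determinant is `Δ(X_{c₀₀}, X_{c₀₁}, X_{c₁₀}, X_{c₁₁})`;
* `blowUp_crossedBlock_asymmetric` — if the four letters `c i j` are pairwise distinct there is a tuple `X`
  with `det(∑ X_l ⊗ s×_l) ≠ det(∑ X_lᵀ ⊗ s×_l)` (witness: elementary matrices, `Δ = 1`);
* `blowUp_crossedBlock_symmetric_of_eq` — if two of the letters coincide the blow-up determinant of the
  crossed block is symmetric under blockwise transposition (a repeated column kills `Δ`).

Dictionary (memo NODE-g45, not formalised): by Goodman–Wallach Thm 5.7.3 the polarised determinants generate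
a copy of `ℂ[Sym² ℂ⁴]`, which carries only EVEN `GL₄`-types, while `Δ·ℂ[q]` carries exactly the types with
four odd parts; so the four-odd part of any `F_X(t)` is read off from `F_X(t)(X) − F_X(t)(Xᵀ)`.  Rank `≤ N+1`
tensors have symmetric blow-up determinants (Cauchy–Binet deficiency `≤ 2`), the crossed design
`s× ⊕ diag` of rank `N+2` has antisymmetric part `Δ · ∏ det X_{γ i}` (this file + K34), whence EVERY
`((2^N),(2^N),ν)` with `ν` four-odd occurs for `⟨m⟩` exactly from `m = N+2` on.
References: Goodman–Wallach, *Symmetry, Representations, and Invariants*, Thm 5.7.3; Fulton–Harris,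
*Representation Theory*, Exercise after Lecture 10 (`SL₂ × SL₂ → SO₄`); Bürgisser–Ikenmeyer 2011, Lemma 6.1,
Remark 6.2; Domokos–Zubkov 2001.
-/

namespace Summit.MatrixMultiplication.MatrixMultiplication.Theorems.ObstructionCalculus

open Matrix BigOperators
open scoped Kronecker
open Literature.Barriers.Langlands.Endoscopy (det_fin_four)

section Gadget

variable {R : Type*} [CommRing R]

/-- **The blow-up gadget.**  Normal form of the determinant of the `2 × 2`-block matrix `[[A,B],[C,D]]`
(rows/columns ordered block-major) in terms of the `SO₄`-invariants of `(Mat₂, det)`: the polarised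
determinants `q(X,Y) = det(X+Y) − det X − det Y` and the bracket `Δ(A,B,C,D) = det[vec A | vec B | vec C | vec D]`
(`vec X = (X₀₀, X₀₁, X₁₀, X₁₁)`):
`2·det = 2 det A det D + 2 det B det C + q(A,D) q(B,C) − q(A,B) q(C,D) − q(A,C) q(B,D) + Δ(A,B,C,D)`.
[this node; folklore ingredients] -/
theorem blowUp_gadget_two_mul_det (A B C D : Matrix (Fin 2) (Fin 2) R) :
    2 * (!![A 0 0, A 0 1, B 0 0, B 0 1; A 1 0, A 1 1, B 1 0, B 1 1;
            C 0 0, C 0 1, D 0 0, D 0 1; C 1 0, C 1 1, D 1 0, D 1 1] : Matrix (Fin 4) (Fin 4) R).det =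
      2 * A.det * D.det + 2 * B.det * C.det
        + ((A + D).det - A.det - D.det) * ((B + C).det - B.det - C.det)
        - ((A + B).det - A.det - B.det) * ((C + D).det - C.det - D.det)
        - ((A + C).det - A.det - C.det) * ((B + D).det - B.det - D.det)
        + (!![A 0 0, B 0 0, C 0 0, D 0 0; A 0 1, B 0 1, C 0 1, D 0 1;
              A 1 0, B 1 0, C 1 0, D 1 0; A 1 1, B 1 1, C 1 1, D 1 1] : Matrix (Fin 4) (Fin 4) R).det := by
  simp [det_fin_four, Matrix.det_fin_two, Matrix.add_apply]
  ring

/-- **Antisymmetric part = bracket.**  Under blockwise transposition `X ↦ Xᵀ` (an improper isometry of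
`(Mat₂, det)`) the block determinant changes exactly by the bracket:
`det[[A,B],[C,D]] − det[[Aᵀ,Bᵀ],[Cᵀ,Dᵀ]] = Δ(A,B,C,D)` over any commutative ring. [this node] -/
theorem blowUp_gadget_det_sub_det_transpose (A B C D : Matrix (Fin 2) (Fin 2) R) :
    (!![A 0 0, A 0 1, B 0 0, B 0 1; A 1 0, A 1 1, B 1 0, B 1 1;
        C 0 0, C 0 1, D 0 0, D 0 1; C 1 0, C 1 1, D 1 0, D 1 1] : Matrix (Fin 4) (Fin 4) R).det -
      (!![Aᵀ 0 0, Aᵀ 0 1, Bᵀ 0 0, Bᵀ 0 1; Aᵀ 1 0, Aᵀ 1 1, Bᵀ 1 0, Bᵀ 1 1;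
          Cᵀ 0 0, Cᵀ 0 1, Dᵀ 0 0, Dᵀ 0 1; Cᵀ 1 0, Cᵀ 1 1, Dᵀ 1 0, Dᵀ 1 1] : Matrix (Fin 4) (Fin 4) R).det =
      (!![A 0 0, B 0 0, C 0 0, D 0 0; A 0 1, B 0 1, C 0 1, D 0 1;
          A 1 0, B 1 0, C 1 0, D 1 0; A 1 1, B 1 1, C 1 1, D 1 1] : Matrix (Fin 4) (Fin 4) R).det := by
  simp [det_fin_four, Matrix.transpose_apply]
  ring

/-- The polarised determinant is invariant under transposition: `q(Xᵀ,Yᵀ) = q(X,Y)`. [folklore] -/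
theorem blowUp_polarDet_transpose (X Y : Matrix (Fin 2) (Fin 2) R) :
    (Xᵀ + Yᵀ).det - Xᵀ.det - Yᵀ.det = (X + Y).det - X.det - Y.det := by
  rw [← Matrix.transpose_add, Matrix.det_transpose, Matrix.det_transpose, Matrix.det_transpose]

/-- The bracket is negated by blockwise transposition: `Δ(Aᵀ,Bᵀ,Cᵀ,Dᵀ) = −Δ(A,B,C,D)` (transposition
swaps the two middle coordinates of `vec`, an odd permutation of the rows). [this node] -/
theorem blowUp_bracket_transpose (A B C D : Matrix (Fin 2) (Fin 2) R) :
    (!![Aᵀ 0 0, Bᵀ 0 0, Cᵀ 0 0, Dᵀ 0 0; Aᵀ 0 1, Bᵀ 0 1, Cᵀ 0 1, Dᵀ 0 1;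
        Aᵀ 1 0, Bᵀ 1 0, Cᵀ 1 0, Dᵀ 1 0; Aᵀ 1 1, Bᵀ 1 1, Cᵀ 1 1, Dᵀ 1 1] : Matrix (Fin 4) (Fin 4) R).det =
      -(!![A 0 0, B 0 0, C 0 0, D 0 0; A 0 1, B 0 1, C 0 1, D 0 1;
          A 1 0, B 1 0, C 1 0, D 1 0; A 1 1, B 1 1, C 1 1, D 1 1] : Matrix (Fin 4) (Fin 4) R).det := by
  simp [det_fin_four, Matrix.transpose_apply]
  ring

end Gadget

section Pencil

variable {R : Type*} [CommRing R] {n : ℕ}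

/-- **The blow-up determinant of a `2 × 2 × n` tensor is a `2 × 2`-block determinant.**  For
`s : Fin 2 → Fin 2 → Fin n → R` and a tuple `X` of `2 × 2` matrices, with blocks
`Y i j := ∑_l s i j l • X l`, `det(∑_l X_l ⊗ s(·,·,l)) = det[[Y₀₀,Y₀₁],[Y₁₀,Y₁₁]]`. [this node] -/
theorem blowUp_pencil_two_det (X : Fin n → Matrix (Fin 2) (Fin 2) R) (s : Fin 2 → Fin 2 → Fin n → R) :
    (∑ l, X l ⊗ₖ Matrix.of (fun i j => s i j l)).det =
      (!![(∑ l, s 0 0 l • X l) 0 0, (∑ l, s 0 0 l • X l) 0 1, (∑ l, s 0 1 l • X l) 0 0, (∑ l, s 0 1 l • X l) 0 1;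
          (∑ l, s 0 0 l • X l) 1 0, (∑ l, s 0 0 l • X l) 1 1, (∑ l, s 0 1 l • X l) 1 0, (∑ l, s 0 1 l • X l) 1 1;
          (∑ l, s 1 0 l • X l) 0 0, (∑ l, s 1 0 l • X l) 0 1, (∑ l, s 1 1 l • X l) 0 0, (∑ l, s 1 1 l • X l) 0 1;
          (∑ l, s 1 0 l • X l) 1 0, (∑ l, s 1 0 l • X l) 1 1, (∑ l, s 1 1 l • X l) 1 0, (∑ l, s 1 1 l • X l) 1 1]
        : Matrix (Fin 4) (Fin 4) R).det := by
  -- reindex `Fin 2 × Fin 2` (Kronecker order `(a,i)`) by `Fin 4` (block-major order `2i + a`)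
  let E : Fin 4 ≃ Fin 2 × Fin 2 :=
    { toFun := ![((0 : Fin 2), (0 : Fin 2)), (1, 0), (0, 1), (1, 1)]
      invFun := fun p => ![![(0 : Fin 4), 2], ![1, 3]] p.1 p.2
      left_inv := by decide
      right_inv := by decide }
  rw [← Matrix.det_submatrix_equiv_self E]
  congr 1
  ext r c
  have hsum : ∀ (i j : Fin 2) (a b : Fin 2),
      (∑ l, X l ⊗ₖ Matrix.of (fun i j => s i j l)) (a, i) (b, j) = (∑ l, s i j l • X l) a b := by
    intro i j a b
    simp only [Matrix.sum_apply, Matrix.kroneckerMap_apply, Matrix.of_apply, Matrix.smul_apply,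
      smul_eq_mul]
    exact Finset.sum_congr rfl fun l _ => mul_comm _ _
  fin_cases r <;> fin_cases c <;>
    simp [Matrix.submatrix_apply, Matrix.of_apply, Equiv.coe_fn_mk, hsum, E]

/-- **Crossed block: antisymmetric part of the blow-up determinant.**  For the `2 × 2 × n` tensor with
slices `s×(i,j,l) = [l = c i j]` (a restriction of the unit tensor `⟨4⟩`: four rank-one terms
`e_i ⊗ e_j ⊗ e_{c i j}`), the blow-up determinant changes under blockwise transposition of `X` exactly by
the bracket of the four letters: `det(∑ X_l ⊗ s×_l) − det(∑ X_lᵀ ⊗ s×_l) = Δ(X_{c₀₀}, X_{c₀₁}, X_{c₁₀}, X_{c₁₁})`.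
[this node] -/
theorem blowUp_crossedBlock_det_sub_det_transpose (X : Fin n → Matrix (Fin 2) (Fin 2) R)
    (c : Fin 2 → Fin 2 → Fin n) :
    (∑ l, X l ⊗ₖ Matrix.of (fun i j => if l = c i j then (1 : R) else 0)).det -
      (∑ l, (X l)ᵀ ⊗ₖ Matrix.of (fun i j => if l = c i j then (1 : R) else 0)).det =
      (!![X (c 0 0) 0 0, X (c 0 1) 0 0, X (c 1 0) 0 0, X (c 1 1) 0 0;
          X (c 0 0) 0 1, X (c 0 1) 0 1, X (c 1 0) 0 1, X (c 1 1) 0 1;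
          X (c 0 0) 1 0, X (c 0 1) 1 0, X (c 1 0) 1 0, X (c 1 1) 1 0;
          X (c 0 0) 1 1, X (c 0 1) 1 1, X (c 1 0) 1 1, X (c 1 1) 1 1] : Matrix (Fin 4) (Fin 4) R).det := by
  have hY : ∀ (Z : Fin n → Matrix (Fin 2) (Fin 2) R) (i j : Fin 2),
      (∑ l, (if l = c i j then (1 : R) else 0) • Z l) = Z (c i j) := by
    intro Z i j
    rw [Finset.sum_eq_single (c i j)]
    · simp
    · intro l _ hl; simp [hl]
    · simp
  rw [blowUp_pencil_two_det X, blowUp_pencil_two_det (fun l => (X l)ᵀ)]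
  simp only [hY]
  exact blowUp_gadget_det_sub_det_transpose (X (c 0 0)) (X (c 0 1)) (X (c 1 0)) (X (c 1 1))

/-- **The crossed block is transposition-asymmetric** as soon as its four letters are pairwise distinct:
some tuple `X` of `2 × 2` matrices has `det(∑ X_l ⊗ s×_l) ≠ det(∑ X_lᵀ ⊗ s×_l)` (witness: the elementary
matrices `E₀₀, E₀₁, E₁₀, E₁₁` on the four letters, for which the bracket is `det 1 = 1`).  In the dictionary
of the node: the blow-up determinant of the crossed block has a NON-ZERO four-odd (`Δ·ℂ[q]`) part —
the source of every four-odd type `((2^N),(2^N),ν)` at rank `N + 2`. [this node] -/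
theorem blowUp_crossedBlock_asymmetric [Nontrivial R] (c : Fin 2 → Fin 2 → Fin n)
    (hc : ∀ i j i' j', c i j = c i' j' → i = i' ∧ j = j') :
    ∃ X : Fin n → Matrix (Fin 2) (Fin 2) R,
      (∑ l, X l ⊗ₖ Matrix.of (fun i j => if l = c i j then (1 : R) else 0)).det ≠
        (∑ l, (X l)ᵀ ⊗ₖ Matrix.of (fun i j => if l = c i j then (1 : R) else 0)).det := by
  classical
  -- the witness: X_{c i j} := E_{i j}
  refine ⟨fun l => Matrix.of (fun a b => if l = c a b then (1 : R) else 0), ?_⟩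
  intro h
  have h0 := blowUp_crossedBlock_det_sub_det_transpose
    (fun l => Matrix.of (fun a b : Fin 2 => if l = c a b then (1 : R) else 0)) c
  rw [h, sub_self] at h0
  -- evaluate the bracket at the witness: it is the identity matrix
  have hval : ∀ i j a b : Fin 2, (if c i j = c a b then (1 : R) else 0) = if (i = a ∧ j = b) then 1 else 0 := by
    intro i j a b
    by_cases hab : i = a ∧ j = b
    · rcases hab with ⟨rfl, rfl⟩; simp
    · rw [if_neg hab, if_neg]; intro hc'; exact hab (hc _ _ _ _ hc')
  simp only [Matrix.of_apply, hval] at h0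
  simp [det_fin_four] at h0

/-- **Repeated letter ⇒ symmetric.**  If two of the four letters of the crossed block coincide, its blow-up
determinant is symmetric under blockwise transposition (the bracket has two equal columns).  In the
dictionary: such a block has no four-odd part — cf. the null designs `γ(N) = γ(N+1)` of NODE-g44 §4. [this node] -/
theorem blowUp_crossedBlock_symmetric_of_eq (X : Fin n → Matrix (Fin 2) (Fin 2) R)
    (c : Fin 2 → Fin 2 → Fin n) (h : c 0 1 = c 1 0) :
    (∑ l, X l ⊗ₖ Matrix.of (fun i j => if l = c i j then (1 : R) else 0)).det =
      (∑ l, (X l)ᵀ ⊗ₖ Matrix.of (fun i j => if l = c i j then (1 : R) else 0)).det := by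
  have h0 := blowUp_crossedBlock_det_sub_det_transpose X c
  rw [h] at h0
  have hzero : (!![X (c 0 0) 0 0, X (c 1 0) 0 0, X (c 1 0) 0 0, X (c 1 1) 0 0;
      X (c 0 0) 0 1, X (c 1 0) 0 1, X (c 1 0) 0 1, X (c 1 1) 0 1;
      X (c 0 0) 1 0, X (c 1 0) 1 0, X (c 1 0) 1 0, X (c 1 1) 1 0;
      X (c 0 0) 1 1, X (c 1 0) 1 1, X (c 1 0) 1 1, X (c 1 1) 1 1] : Matrix (Fin 4) (Fin 4) R).det = 0 := by
    simp [det_fin_four]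
  rw [hzero] at h0
  exact sub_eq_zero.mp h0

end Pencil

end Summit.MatrixMultiplication.MatrixMultiplication.Theorems.ObstructionCalculus
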